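import Mathlib.CategoryTheory.ObjectProperty.ClosedUnderIsomorphisms
import Literature.AnabelianGeometry.EtaleTheta.ThetaFrobenioidToyGenuine
import Literature.AnabelianGeometry.EtaleTheta.Discharge.Sec3Example39Base

/-!
# [EtTh] Example 3.9 (ii) and (iv): the named Props `ellCompatible` and `Example39_iv_facts` as
# SCHEMATA over the data interface `Example39Data` (FACT-LIST rows F-0617, F-0616; proof-only)

S. Mochizuki, *The étale theta function and its Frobenioid-theoretic manifestations*, Publ. RIMS **45**
(2009) [MochizukiEtTh2009], Example 3.9, PDF pp. 83–85 (printed 309–311).  (ii), p. 83 l. −9 – p. 84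
l. 1: "by taking the left adjoints to the natural inclusion functors `D_Y^ell → D_Y`, `D_W^ell → D_W`, we
obtain natural functors `D_Y → D_Y^ell`, `D_W → D_W^ell` [cf. [Mzk18], Example 1.3, (ii)], as well as
1-commutative diagrams of natural functors [`D_Y^ell → D_Y → D_W` against `D_Y^ell → D_W^ell → D_W`, and
`D_Y → D_Y^ell → D_W^ell` against `D_Y → D_W → D_W^ell`] [since `Y^log → W^log` is unramified at the cusps
of `Y^log`]" [cite: MochizukiEtTh2009, Ex 3.9 p.83]; (iv), p. 85 l. 28–35: "the monoid `Φ_α^ell` is also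
rational … of rationally standard type … with perfect divisor monoid over the slim [cf. Remark 3.7.2]
base category `D_α` of FSM-type [cf. Remark 3.7.2]" [cite: MochizukiEtTh2009, Ex 3.9 p.85].

PROOF-ONLY companion of abc-iut-L2-t3's `ThetaFrobenioid.lean` (abc-iut cell, block F fact-proving
wave, seat abc-iut-f-145, tranche 145; FACT-LIST rows **F-0617**
`Literature.AnabelianGeometry.EtaleTheta.Example39Data.ellCompatible` and **F-0616**
`Literature.AnabelianGeometry.EtaleTheta.Example39Data.Example39_iv_facts`, both
`kernel_closedness = parametrised`).  Both named Props are predicates on abc-iut-L2-t3's DATA structure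
`E : Example39Data V DW TW` — (i)–(iii) typed as four abstract categories with functors, two abstract
object properties `ellY ⊆ D_Y`, `ellW ⊆ D_W` WITH left adjoints, and a subfunctor `Φ_W^ell ⊆ Φ_W^ℝ` —
so their universal closures quantify over interface fields that print instantiates with specific curves.
Kernel truth table (plan FACT-LIST header, rule R5):

* **F-0617 `ellCompatible`** ("the first 1-commutative diagram of (ii)": `Y → W` carries cusp-unramified
  coverings to cusp-unramified coverings).  `ellCompatible_iff_exists_lift` — AS TYPED it is EXACTLY
  the existence of a functor `D_Y^ell → D_W^ell` making the printed square commute on the nose, and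
  `ellCompatible_of_lift_iso` — a 1-commuting lift suffices once `D_W^ell` is replete;
  `ellW_of_discrete` / `ellCompatible_of_discrete` — over a DISCRETE base `D_W` (the shape of every
  inhabitant in the tree: abc-iut-w5's `Toy.example39Data`, p429770) a reflective `D_W^ell` is all of `D_W`,
  so the Prop HOLDS for every datum there (`Toy.example39Data_ellCompatible`); but
  `exists_not_ellCompatible_fin2` / **`not_forall_ellCompatible`** — over the walking arrow `0 → 1`
  (`Fin 2`) with `D_Y = D_W`, `Y → W` the identity, `D_Y^ell := D_Y` and `D_W^ell := {1}` (reflective: `1` is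
  terminal), the object `0` is "cusp-unramified over `Y`" but not "over `W`": the universal closure is
  REFUTED.  So F-0617 is a SCHEMA: a constraint relating the free fields `ellY`, `ellW`, `fYW` (what print
  derives from "`Y^log → W^log` unramified at the cusps"), admissible only as a hypothesis on `E` / at
  instances; it holds at the tree's named instance.
* **F-0616 `Example39_iv_facts`** (`Φ_α^ell` rational ∧ `D_α` slim ∧ `D_α` of FSM-type).
  `example39_iv_facts_iff_isRational` — over a slim base of FSM-type the Prop is EXACTLY the rationality
  clause (abc-iut-L2-t9's reduction `example39_iv_facts_of`, p410936, plus the converse); at the named toy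
  datum (`Toy.example39Data`, `α := 𝟙`, the proved hypothesis structure `Toy.frobenioidHyp_example39Data R S`
  over the tree vocabulary `treeCatVocab _ R S` whose rationality slot `R` is a free PARAMETER — [FrdI]
  Def. 4.5 (ii) is not in the tree) `Toy.isSlim_Dα` holds outright and
  **`Toy.example39_iv_facts_iff : … ↔ R (Φ_α^ell)`**: PROVED at `R := ⊤` (`Toy.example39_iv_facts_of_isRational`),
  FALSE at `R := ⊥`, whence **`not_forall_example39_iv_facts`**: the universal closure (over all
  vocabularies) is REFUTED.  F-0616 is a SCHEMA whose non-vocabulary content (slim, FSM-type) is a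
  theorem at the instance and reduced in general; the rationality conjunct is exactly as strong as the
  vocabulary slot it is read in.

HONEST FRAMING: statements about the TYPED predicates over abstract interface data and over the tree's
degenerate consistency witnesses (one-object / two-object bases, trivial [FrdI] monoid vocabulary
`Toy.monoidVocab` for the countermodel); nothing of [EtTh] is asserted or denied; no side is taken on
[IUTchIII] Cor. 3.12; typed ≠ proved; a countermodel to a universal closure says the closure was never the
fact.  No definitions, no instances, no Prop facts.
-/

noncomputable section

namespace Literature.AnabelianGeometry.EtaleTheta

open CategoryTheory Opposite Literature.AlgebraicGeometry.Frobenioids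

universe u v w

namespace Example39Data

variable {V : FrdIMonoidStub.{w}} {DW : Type u} [Category.{v} DW]
  {TW : RealifiedDivisorMonoids (D₀ := DW) V} (E : Example39Data V DW TW)

/-! ### F-0617 `ellCompatible`: what the Prop says -/

/-- `ellCompatible` unfolded in Mathlib's vocabulary: `D_Y^ell ≤ (D_W^ell)` pulled back along `D_Y → D_W`.
[cite: MochizukiEtTh2009, Ex 3.9 p.83] -/
theorem ellCompatible_iff_le_inverseImage :
    E.ellCompatible ↔ E.ellY ≤ E.ellW.inverseImage E.fYW := Iff.rfl

/-- If every object of `D_Y^ell` maps into `D_W^ell` pointwise, `ellCompatible` holds (bookkeeping form).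
[cite: MochizukiEtTh2009, Ex 3.9 p.83] -/
theorem ellCompatible_of_forall_ellW (h : ∀ B : DW, E.ellW B) : E.ellCompatible := fun _ _ => h _

/-- **`ellCompatible` AS TYPED is exactly the printed diagram commuting on the nose**: it holds iff there
is a functor `D_Y^ell → D_W^ell` with `(D_Y^ell → D_W^ell → D_W) = (D_Y^ell → D_Y → D_W)` — the first
diagram of Example 3.9 (ii) (p. 83), in its `0`-commutative form. [cite: MochizukiEtTh2009, Ex 3.9 p.83] -/
theorem ellCompatible_iff_exists_lift :
    E.ellCompatible ↔
      ∃ F : E.ellY.FullSubcategory ⥤ E.ellW.FullSubcategory, F ⋙ E.ellW.ι = E.ellY.ι ⋙ E.fYW := by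
  constructor
  · intro h
    exact ⟨E.ellW.lift (E.ellY.ι ⋙ E.fYW) fun A => h A.obj A.property, rfl⟩
  · rintro ⟨F, hF⟩ A hA
    change E.ellW ((E.ellY.ι ⋙ E.fYW).obj ⟨A, hA⟩)
    rw [← Functor.congr_obj hF ⟨A, hA⟩]
    exact (F.obj ⟨A, hA⟩).property

/-- **The printed `1`-commutative form suffices when `D_W^ell` is replete** (closed under isomorphisms —
as "unramified over the cusps" is): a functor `D_Y^ell → D_W^ell` with an ISOMORPHISM
`(D_Y^ell → D_W^ell → D_W) ≅ (D_Y^ell → D_Y → D_W)` gives `ellCompatible`. [cite: MochizukiEtTh2009, Ex 3.9 p.83] -/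
theorem ellCompatible_of_lift_iso [E.ellW.IsClosedUnderIsomorphisms]
    (F : E.ellY.FullSubcategory ⥤ E.ellW.FullSubcategory) (e : F ⋙ E.ellW.ι ≅ E.ellY.ι ⋙ E.fYW) :
    E.ellCompatible := fun A hA =>
  E.ellW.prop_of_iso (e.app ⟨A, hA⟩) (F.obj ⟨A, hA⟩).property

/-! ### F-0617 holds over every discrete base (the shape of the tree's inhabitants) -/

/-- Over a DISCRETE base category `D_W` a reflective full subcategory is everything: the unit
`B → ι (L B)` of `(D_W → D_W^ell) ⊣ (D_W^ell ⊆ D_W)` is an arrow of a discrete category, so `B = L B ∈ D_W^ell`.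
[cite: MochizukiEtTh2009, Ex 3.9 p.83] -/
theorem ellW_of_discrete {X : Type u} {V : FrdIMonoidStub.{w}}
    {TW : RealifiedDivisorMonoids (D₀ := Discrete X) V} (E : Example39Data V (Discrete X) TW)
    (B : Discrete X) : E.ellW B := by
  have h : B = (E.toEllW.obj B).obj := Discrete.ext (Discrete.eq_of_hom (E.adjW.unit.app B))
  rw [h]
  exact (E.toEllW.obj B).property

/-- Hence **`ellCompatible` holds for EVERY `Example39Data` over a discrete base `D_W`** (instance-form
of F-0617 at the only base shape inhabited in the tree). [cite: MochizukiEtTh2009, Ex 3.9 p.83] -/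
theorem ellCompatible_of_discrete {X : Type u} {V : FrdIMonoidStub.{w}}
    {TW : RealifiedDivisorMonoids (D₀ := Discrete X) V} (E : Example39Data V (Discrete X) TW) :
    E.ellCompatible :=
  E.ellCompatible_of_forall_ellW E.ellW_of_discrete

/-! ### F-0617: the universal closure is REFUTED over the walking arrow -/

/-- The Def. 3.6 (i) data interface is inhabited over EVERY small base category, degenerately: constant
monoids `Φ₀ = Φ₀^ℝ = ℕ`, `B₀ = B₀^Λ = ℤ`, trivial divisor maps, `F₀ = B₀`, `ℝ·Φ₀^cnst =` everything, `Λ = ℤ`,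
over the trivial [FrdI] monoid vocabulary (abc-iut-L2-t3's `Toy.realified`, transported from the one-object
base to an arbitrary one).  Consistency data for countermodels only. [cite: MochizukiEtTh2009, Def 3.6 p.76] -/
theorem nonempty_realifiedDivisorMonoids_toyVocab (D₀ : Type) [SmallCategory D₀] :
    Nonempty (RealifiedDivisorMonoids (D₀ := D₀) Toy.monoidVocab) :=
  ⟨{ Φ₀ := (Functor.const _).obj (CommMonCat.of (Multiplicative ℕ))
     B₀ := (Functor.const _).obj (CommMonCat.of (Multiplicative ℤ))
     isUnit_B₀ := fun _ b => by
       change IsUnit (M := Multiplicative ℤ) b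
       exact Group.isUnit _
     div₀ := fun _ => 1
     div₀_natural := fun _ _ => by simp only [MonoidHom.one_apply, map_one]
     F₀ := fun _ => ⊤
     F₀_map := fun _ _ _ => trivial
     ncsp₀ := fun _ => ⊤
     csp₀ := fun _ => ⊥
     ncsp₀_map := fun _ _ _ => trivial
     csp₀_map := fun _ x hx => by
       rw [Submonoid.mem_bot] at hx ⊢
       rw [hx, map_one]
     existsUnique_ncsp_csp := fun _ x => by
       refine ⟨(⟨x, trivial⟩, ⟨1, Submonoid.mem_bot.mpr rfl⟩), mul_one x, ?_⟩
       rintro ⟨a, c⟩ h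
       have hc : c.1 = 1 := Submonoid.mem_bot.mp c.2
       have ha : a.1 = x := by
         have h' : a.1 * c.1 = x := h
         rwa [hc, mul_one] at h'
       exact Prod.ext (Subtype.ext ha) (Subtype.ext hc)
     Λ := MonoidType.Z
     ΦR := (Functor.const _).obj (CommMonCat.of (Multiplicative ℕ))
     toR := fun _ => MonoidHom.id _
     toR_natural := fun _ _ => rfl
     isRealification := fun _ => trivial
     BΛ := (Functor.const _).obj (CommMonCat.of (Multiplicative ℤ))
     isUnit_BΛ := fun _ b => by
       change IsUnit (M := Multiplicative ℤ) b
       exact Group.isUnit _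
     divΛ := fun _ => 1
     divΛ_natural := fun _ _ => by simp only [MonoidHom.one_apply, map_one]
     FΛ := fun _ => ⊤
     FΛ_map := fun _ _ _ => trivial
     cnstR := fun _ => ⊤
     cnstR_map := fun _ _ _ => trivial
     divΛ_mem_cnstR := fun _ _ _ => trivial
     cnstR_root := fun _ _ _ _ => trivial
     cnst_le_cnstR := fun _ _ _ => trivial
     ncspR := fun _ => ⊤
     cspR := fun _ => ⊥
     toR_ncsp := fun _ _ _ => trivial
     toR_csp := fun _ _ hx => hx }⟩

/-- **Countermodel family for F-0617 over the walking arrow `0 → 1` (`Fin 2`)**: for ANY Def. 3.6 (i) data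
over `Fin 2` (trivial monoid vocabulary) there is an Example 3.9 (i)–(iii) datum violating `ellCompatible`:
`D_U = D_X = D_Y = D_W := Fin 2`, all four functors identities, `D_Y^ell := D_Y` (left adjoint from
`ObjectProperty.topEquivalence`), `D_W^ell := {1}` — reflective, the left adjoint being the constant functor
at the terminal object `1` —, `Φ_W^ell := 1` (trivial submonoid: perfect, group-saturated); then `0 ∈ D_Y^ell`
but `0 ∉ D_W^ell`. [cite: MochizukiEtTh2009, Ex 3.9 p.83] -/
theorem exists_not_ellCompatible_fin2 (TW : RealifiedDivisorMonoids (D₀ := Fin 2) Toy.monoidVocab) :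
    ∃ E : Example39Data Toy.monoidVocab (Fin 2) TW, ¬ E.ellCompatible := by
  have hle : ∀ j : Fin 2, j ≤ 1 := by decide
  refine ⟨{ DU := Fin 2
            DX := Fin 2
            DY := Fin 2
            fUX := 𝟭 _
            fUY := 𝟭 _
            fXW := 𝟭 _
            fYW := 𝟭 _
            oneComm := Iso.refl _
            ellY := ⊤
            ellW := fun j => j = 1
            toEllY := (ObjectProperty.topEquivalence (Fin 2)).inverse
            adjY := (ObjectProperty.topEquivalence (Fin 2)).symm.toAdjunction
            toEllW := (Functor.const (Fin 2)).obj ⟨1, rfl⟩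
            adjW := Adjunction.mkOfHomEquiv
              { homEquiv := fun X Y =>
                  { toFun := fun _ => homOfLE ((hle X).trans_eq Y.property.symm)
                    invFun := fun _ => ObjectProperty.homMk (eqToHom Y.property.symm)
                    left_inv := fun _ => ObjectProperty.hom_ext _ (Subsingleton.elim _ _)
                    right_inv := fun _ => Subsingleton.elim _ _ }
                homEquiv_naturality_left_symm := fun _ _ => ObjectProperty.hom_ext _ (Subsingleton.elim _ _)
                homEquiv_naturality_right := fun _ _ => Subsingleton.elim _ _ }
            ΦellW :=
              { carrier := fun _ => ⊥
                map_mem := fun f x hx => by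
                  rw [Submonoid.mem_bot] at hx ⊢
                  rw [hx, map_one] }
            isPerfect := fun A => ?_
            isGroupSaturated := fun A => ?_
            isPerfFactorial := fun _ => trivial
            isNonDilating := fun _ _ => trivial }, fun h => ?_⟩
  · -- the trivial monoid is perfect
    show IsPerfect (⊥ : Submonoid (TW.ΦR.obj A))
    haveI : Subsingleton (⊥ : Submonoid (TW.ΦR.obj A)) :=
      ⟨fun a b => Subtype.ext ((Submonoid.mem_bot.1 a.2).trans (Submonoid.mem_bot.1 b.2).symm)⟩
    exact ⟨fun n _ => Function.bijective_of_subsingleton _⟩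
  · -- the trivial submonoid is group-saturated
    show IsGroupSaturated (⊥ : Submonoid (TW.ΦR.obj A))
    refine (isGroupSaturated_iff' _).2 fun q a ha b hb h => ?_
    rw [Submonoid.mem_bot] at ha hb ⊢
    rw [hb, mul_one] at h
    exact h.trans ha
  · -- `0 ∈ D_Y^ell = D_Y` but `Y → W = id` and `0 ∉ D_W^ell = {1}`
    exact absurd (h 0 trivial) (show ¬ ((0 : Fin 2) = 1) by decide)

/-- **F-0617, universal closure REFUTED**: it is NOT the case that every Example 3.9 (i)–(iii) datum
satisfies `ellCompatible` (walking-arrow countermodel over the degenerate Def. 3.6 (i) data).  The Prop is a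
SCHEMA — a constraint on the free fields `ellY`, `ellW`, `fYW` — admissible as a hypothesis on `E` / at named
instances only. [cite: MochizukiEtTh2009, Ex 3.9 p.83] -/
theorem not_forall_ellCompatible :
    ¬ ∀ (V : FrdIMonoidStub.{0}) (DW : Type) [SmallCategory DW] (TW : RealifiedDivisorMonoids (D₀ := DW) V)
        (E : Example39Data V DW TW), E.ellCompatible := by
  intro h
  obtain ⟨TW⟩ := nonempty_realifiedDivisorMonoids_toyVocab (Fin 2)
  obtain ⟨E, hE⟩ := exists_not_ellCompatible_fin2 TW
  exact hE (h _ _ TW E)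

/-! ### F-0616 `Example39_iv_facts`: reduction to the rationality clause over slim bases of FSM-type -/

variable {A B : DW} (α : A ⟶ B)

/-- The rationality conjunct of `Example39_iv_facts` (bookkeeping). [cite: MochizukiEtTh2009, Ex 3.9 p.85] -/
theorem isRational_of_example39_iv_facts {VD : FrdICatStub.{max u v, v, w} (Dα α)} (h : E.FrobenioidHyp α VD)
    (hf : E.Example39_iv_facts α h) : (E.thetaFrobenioid α h).IsRational :=
  hf.1

/-- **Over a slim base `D_W` of FSM-type, `Example39_iv_facts` IS the rationality clause** (abc-iut-L2-t9's
`example39_iv_facts_of` — slices of slim / FSM-type categories are slim / of FSM-type — plus the trivial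
converse).  Remark 3.7.2 (p. 80): "`D₀` is slim … and of FSM-type" is the printed input for `D_W`.
[cite: MochizukiEtTh2009, Ex 3.9 p.85] -/
theorem example39_iv_facts_iff_isRational (hslim : IsSlim DW) (hfsm : IsOfFSMType DW)
    {VD : FrdICatStub.{max u v, v, w} (Dα α)} (h : E.FrobenioidHyp α VD) :
    E.Example39_iv_facts α h ↔ (E.thetaFrobenioid α h).IsRational :=
  ⟨fun hf => hf.1, fun hr => example39_iv_facts_of α E h hr hslim hfsm⟩

end Example39Data

/-! ### F-0616 and F-0617 at the tree's named instance `Toy.example39Data` (`α := 𝟙`) -/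

namespace Toy

/-- **F-0617 at the named toy datum**: `ellCompatible` HOLDS (`D_W^ell = D_W`; also an instance of
`ellCompatible_of_discrete`). [cite: MochizukiEtTh2009, Ex 3.9 p.83] -/
theorem example39Data_ellCompatible : example39Data.ellCompatible :=
  example39Data.ellCompatible_of_discrete

/-- **"the slim base category `D_α`"** (Ex. 3.9 (iv), p. 85) at the toy: `D_α = (D_W)_W[𝟙]` has one-element
hom-sets, so every slice-forgetful functor on it is rigid. [cite: MochizukiEtTh2009, Ex 3.9 p.85] -/
theorem isSlim_Dα : IsSlim (Example39Data.Dα (𝟙 basePt)) :=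
  ⟨fun _ _ => Iso.ext (NatTrans.ext (funext fun _ => (subsingleton_hom_Dα _ _).elim _ _))⟩

variable (R S : ((Example39Data.Dα (𝟙 basePt))ᵒᵖ ⥤ CommMonCat.{0}) → Prop)

/-- **F-0616 at the named toy datum, exact truth value**: with the hypothesis structure
`frobenioidHyp_example39Data R S` (proved, p429770) over the tree vocabulary `treeCatVocab _ R S`,
`Example39_iv_facts` holds IFF the rationality slot `R` holds at `Φ_α^ell` — the base-category conjuncts
(`D_α` slim, of FSM-type) being THEOREMS (`isSlim_Dα`, `isOfFSMType_Dα`). [cite: MochizukiEtTh2009, Ex 3.9 p.85] -/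
theorem example39_iv_facts_iff :
    example39Data.Example39_iv_facts (𝟙 basePt) (frobenioidHyp_example39Data R S) ↔
      R (example39Data.Φα (𝟙 basePt)).toFunctor :=
  ⟨fun h => h.1, fun h => ⟨h, isSlim_Dα, isOfFSMType_Dα⟩⟩

/-- **F-0616 PROVED at the named toy datum in any vocabulary whose rationality slot holds at `Φ_α^ell`**
(e.g. `R := ⊤`). [cite: MochizukiEtTh2009, Ex 3.9 p.85] -/
theorem example39_iv_facts_of_isRational (hR : R (example39Data.Φα (𝟙 basePt)).toFunctor) :
    example39Data.Example39_iv_facts (𝟙 basePt) (frobenioidHyp_example39Data R S) :=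
  (example39_iv_facts_iff R S).2 hR

/-- F-0616 at the named toy datum with the all-true rationality vocabulary: HOLDS.
[cite: MochizukiEtTh2009, Ex 3.9 p.85] -/
theorem example39_iv_facts_top :
    example39Data.Example39_iv_facts (𝟙 basePt) (frobenioidHyp_example39Data (fun _ => True) S) :=
  example39_iv_facts_of_isRational _ S trivial

/-- F-0616 at the named toy datum with the all-false rationality vocabulary: FAILS (the rationality clause is
exactly as strong as the vocabulary slot it is read in). [cite: MochizukiEtTh2009, Ex 3.9 p.85] -/
theorem not_example39_iv_facts_bot :
    ¬ example39Data.Example39_iv_facts (𝟙 basePt) (frobenioidHyp_example39Data (fun _ => False) S) :=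
  fun h => h.1

end Toy

/-- **F-0616, universal closure REFUTED**: it is NOT the case that `Example39_iv_facts` holds for every
Example 3.9 datum, every `α`, every category vocabulary `VD` on `D_α` and every hypothesis structure — at the
named toy datum with rationality slot `⊥` it fails.  The Prop is a SCHEMA: admissible as a hypothesis / at
named instances, where its base-category part is a theorem and its rationality part is the vocabulary's.
[cite: MochizukiEtTh2009, Ex 3.9 p.85] -/
theorem Example39Data.not_forall_example39_iv_facts :
    ¬ ∀ (V : FrdIMonoidStub.{0}) (DW : Type) [SmallCategory DW] (TW : RealifiedDivisorMonoids (D₀ := DW) V)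
        (E : Example39Data V DW TW) (A B : DW) (α : A ⟶ B)
        (VD : FrdICatStub.{0, 0, 0} (Example39Data.Dα α)) (h : E.FrobenioidHyp α VD),
        E.Example39_iv_facts α h :=
  fun H => Toy.not_example39_iv_facts_bot (fun _ => True) (H _ _ _ _ _ _ _ _ _)

end Literature.AnabelianGeometry.EtaleTheta

end
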